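import Literature.Probability.LatticeModels.TwoPointLogConvex
import Literature.Probability.LatticeModels.PointwiseScalingLimitEtaExists
import Literature.Probability.LatticeModels.CriticalScalingDimension
import HarnessLib

/-!
# Axis ratio regularity of the critical two-point function on `ℤ³` is a THEOREM
(crux `MoebiusLimitExists`, item stmt-CriticalPhenomena-1344; refuter `drefute` gen-4, line
`only-interaction-breaks-moebius`)

`⟨σ₀σ_{(N+1)e₀}⟩_{β_c} / ⟨σ₀σ_{Ne₀}⟩_{β_c} → 1` (`criticalTwoPoint_axis_ratio_tendsto_one`), hence
`⟨σ₀σ_{(N+j)e₀}⟩_{β_c} / ⟨σ₀σ_{Ne₀}⟩_{β_c} → 1` for every fixed `j` (`criticalTwoPoint_axis_ratio_shift_tendsto_one`).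

Why this is filed next to the crux. The standing disprover's `Disproof.lean` §F.1(b)(iii) lists AXIS
RATIO REGULARITY among the OPEN lattice consequences of `stub_compactness`
(`twoPoint_axis_ratio_of_stub`), and `Negative/RatioRegularCorollaries.lean` presents ratio
regularity `⟨σ₀σ_{x+u}⟩/⟨σ₀σ_x⟩ → 1` as open on `ℤ³`. Along a coordinate AXIS it is not open: it
follows from three tree theorems — exact LOG-CONVEXITY of `N ↦ ⟨σ₀σ_{Ne₀}⟩` at `m*(β_c) = 0`
(reflection positivity / transfer matrix, `twoPointPlus_axisPair_sq_le`, Aizenman–Duminil-Copin 2021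
Prop. 5.3), Messager–Miracle-Solé axis MONOTONICITY (`criticalTwoPoint_axis_antitone`), and the
Simon–Lieb LOWER BOUND `⟨σ₀σ_x⟩_{β_c} ≥ c‖x‖⁻²` (`criticalTwoPoint_bounds_holds`): the one-step ratio
`r(N) = G(N+1)/G(N)` is non-decreasing and `≤ 1`, so it converges to `L ≤ 1`, and `L < 1` would give
geometric decay `G(N) ≤ G(0)Lᴺ`, against `cN⁻²`. (The printed quantitative form is ADC 2021
Remark 5.10: `G(Ne₁) − G((N+1)e₁) ≤ (2+o(1)) (log N / N) G(Ne₁)`.) So the `n = 2`, on-axis part of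
the asymptotic-equicontinuity content of STUB 1 holds unconditionally (no item 0634); what remains
open on `ℤ³` is ratio regularity in GENERAL directions, DOUBLING, and everything at `n ≥ 4`.

References: M. Aizenman, H. Duminil-Copin, Ann. of Math. 194 (2021), arXiv:1912.07973, Prop. 5.3,
Prop. 5.9 and Remark 5.10 (p. 19–20 of the arXiv text); A. Messager, S. Miracle-Solé, J. Stat. Phys.
17 (1977); B. Simon, Comm. Math. Phys. 77 (1980) Thm. 1. No definitions are introduced.
-/

noncomputable section

open Filter Topology Set
open Literature.Probability.LatticeModels

namespace Summit.CriticalPhenomena.Ising3DConformalLimit.AxisRatioRegularity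

/-- Reflection-positivity LOG-CONVEXITY along the axis at `β_c` (`m*(β_c) = 0` in `d = 3`):
`⟨σ₀σ_{(N+1)e₀}⟩² ≤ ⟨σ₀σ_{Ne₀}⟩ ⟨σ₀σ_{(N+2)e₀}⟩`.
[cite: AizenmanDuminilCopinAnnals2021, arXiv:1912.07973 Prop. 5.3 (5.17) and §5.5 proof of Prop. 5.9 (p. 19)] -/
theorem criticalTwoPoint_axis_logConvex (N : ℕ) :
    criticalTwoPoint 3 (Pi.single 0 ((N + 1 : ℕ) : ℤ)) ^ 2 ≤
      criticalTwoPoint 3 (Pi.single 0 (N : ℤ)) * criticalTwoPoint 3 (Pi.single 0 ((N + 2 : ℕ) : ℤ)) := by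
  have hm : spontaneousMagnetization (2 + 1) (criticalBeta 3) = 0 :=
    spontaneousMagnetization_criticalBeta_eq_zero_holds (d := 3) (by norm_num)
  have h := twoPointPlus_axisPair_sq_le (d' := 2) (criticalBeta_nonneg 3) hm 0 0 rfl
    (n := N + 1) (by omega)
  rw [zero_add, zero_add, zero_add, Nat.add_sub_cancel] at h
  have e : ∀ M : ℕ, criticalTwoPoint 3 (Pi.single 0 (M : ℤ)) =
      twoPointPlus (2 + 1) (criticalBeta 3) (Pi.single 0 (M : ℤ)) := fun M => rfl
  rw [e, e, e]
  nlinarith [h]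

/-- **AXIS RATIO REGULARITY at criticality on `ℤ³` (a theorem, not an open statement):**
`⟨σ₀σ_{(N+1)e₀}⟩_{β_c} / ⟨σ₀σ_{Ne₀}⟩_{β_c} → 1`. Log-convexity makes the ratio non-decreasing, MMS
bounds it by `1`, and a limit `L < 1` would force geometric decay against Simon–Lieb `≥ cN⁻²`.
[cite: AizenmanDuminilCopinAnnals2021, arXiv:1912.07973 §5.5 Remark 5.10 (p. 20)] -/
theorem criticalTwoPoint_axis_ratio_tendsto_one :
    Tendsto (fun N : ℕ => criticalTwoPoint 3 (Pi.single 0 ((N + 1 : ℕ) : ℤ)) /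
      criticalTwoPoint 3 (Pi.single 0 (N : ℤ))) atTop (𝓝 1) := by
  -- the axis function and its one-step ratio
  obtain ⟨G, hG⟩ : ∃ G : ℕ → ℝ, ∀ N, G N = criticalTwoPoint 3 (Pi.single 0 (N : ℤ)) := ⟨_, fun _ => rfl⟩
  have hpos : ∀ N, 0 < G N := fun N => by rw [hG]; exact criticalTwoPoint_axis_pos N
  have hsucc : ∀ N, G (N + 1) ≤ G N := fun N => by
    rw [hG, hG]; exact criticalTwoPoint_axis_antitone (Nat.le_succ N)
  have hlc : ∀ N, G (N + 1) ^ 2 ≤ G N * G (N + 2) := fun N => by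
    rw [hG, hG, hG]; exact criticalTwoPoint_axis_logConvex N
  obtain ⟨r, hr⟩ : ∃ r : ℕ → ℝ, ∀ N, r N = G (N + 1) / G N := ⟨_, fun _ => rfl⟩
  have hgoal : (fun N : ℕ => criticalTwoPoint 3 (Pi.single 0 ((N + 1 : ℕ) : ℤ)) /
      criticalTwoPoint 3 (Pi.single 0 (N : ℤ))) = r := by
    funext N; rw [hr, hG, hG]
  rw [hgoal]
  have hr_pos : ∀ N, 0 < r N := fun N => by rw [hr]; exact div_pos (hpos _) (hpos _)
  have hr_le : ∀ N, r N ≤ 1 := fun N => by rw [hr, div_le_one (hpos N)]; exact hsucc N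
  have hr_mono : Monotone r := by
    refine monotone_nat_of_le_succ fun N => ?_
    rw [hr, hr, div_le_div_iff₀ (hpos _) (hpos _)]
    have h := hlc N
    nlinarith [h, hpos N, hpos (N + 1), hpos (N + 2)]
  -- monotone and bounded: converges to `L = sup r ≤ 1`, and `r N ≤ L` for all `N`
  have hbdd : BddAbove (range r) := ⟨1, by rintro _ ⟨N, rfl⟩; exact hr_le N⟩
  have hconv : Tendsto r atTop (𝓝 (⨆ N, r N)) := tendsto_atTop_ciSup hr_mono hbdd
  obtain ⟨L, hL⟩ : ∃ L : ℝ, L = ⨆ N, r N := ⟨_, rfl⟩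
  rw [← hL] at hconv
  have hL1 : L ≤ 1 := by rw [hL]; exact ciSup_le hr_le
  have hrL : ∀ N, r N ≤ L := fun N => hr_mono.ge_of_tendsto hconv N
  have hL0 : 0 < L := (hr_pos 0).trans_le (hrL 0)
  suffices hL1' : 1 ≤ L by rwa [le_antisymm hL1 hL1'] at hconv
  by_contra hlt
  rw [not_le] at hlt
  -- geometric decay `G N ≤ G 0 · Lᴺ`
  have htel : ∀ N, G N ≤ G 0 * L ^ N := by
    intro N
    induction N with
    | zero => simp
    | succ N ih =>
      have h1 : G (N + 1) = r N * G N := by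
        rw [hr, div_mul_cancel₀ _ (hpos N).ne']
      rw [h1, pow_succ]
      calc r N * G N ≤ L * G N := mul_le_mul_of_nonneg_right (hrL N) (hpos N).le
        _ ≤ L * (G 0 * L ^ N) := mul_le_mul_of_nonneg_left ih hL0.le
        _ = G 0 * (L ^ N * L) := by ring
  -- Simon–Lieb lower bound `G N ≥ c N⁻²` for `N ≥ 1`
  obtain ⟨c, C, hc, hb⟩ := criticalTwoPoint_bounds_holds (d := 3) le_rfl
  have hlow : ∀ N : ℕ, 1 ≤ N → c * ((N : ℝ) ^ 2)⁻¹ ≤ G N := by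
    intro N hN
    have hx : (Pi.single 0 (N : ℤ) : Site 3) ≠ 0 := by
      intro h
      have h0 := congr_fun h 0
      simp only [Pi.single_eq_same, Pi.zero_apply] at h0
      omega
    have h1 := (hb _ hx).1
    rw [norm_single_axis] at h1
    have habs : |((N : ℤ) : ℝ)| = (N : ℝ) := by push_cast; exact abs_of_nonneg (Nat.cast_nonneg N)
    have hexp : (-(((3 : ℕ) : ℝ) - 1)) = (-2 : ℝ) := by norm_num
    rw [habs, hexp, Real.rpow_neg (Nat.cast_nonneg N), Real.rpow_two] at h1
    rw [hG]
    exact h1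
  -- `N² Lᴺ → 0`, so `c ≤ G 0 · N² Lᴺ → 0`, contradicting `c > 0`
  have hlim : Tendsto (fun N : ℕ => G 0 * ((N : ℝ) ^ 2 * L ^ N)) atTop (𝓝 (G 0 * 0)) :=
    (tendsto_pow_const_mul_const_pow_of_abs_lt_one 2 (by rwa [abs_of_pos hL0])).const_mul _
  rw [mul_zero] at hlim
  have hev : ∀ᶠ N : ℕ in atTop, c ≤ G 0 * ((N : ℝ) ^ 2 * L ^ N) := by
    filter_upwards [eventually_ge_atTop 1] with N hN
    have hN' : (0 : ℝ) < (N : ℝ) ^ 2 := by positivity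
    have h1 := (hlow N hN).trans (htel N)
    rw [mul_inv_le_iff₀ hN'] at h1
    calc c ≤ G 0 * L ^ N * (N : ℝ) ^ 2 := h1
      _ = G 0 * ((N : ℝ) ^ 2 * L ^ N) := by ring
  have hc0 : c ≤ 0 := ge_of_tendsto hlim hev
  linarith

/-- Corollary: `⟨σ₀σ_{(N+j)e₀}⟩_{β_c} / ⟨σ₀σ_{Ne₀}⟩_{β_c} → 1` for every fixed `j` (finite product
of one-step ratios). [folklore] -/
theorem criticalTwoPoint_axis_ratio_shift_tendsto_one (j : ℕ) :
    Tendsto (fun N : ℕ => criticalTwoPoint 3 (Pi.single 0 ((N + j : ℕ) : ℤ)) /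
      criticalTwoPoint 3 (Pi.single 0 (N : ℤ))) atTop (𝓝 1) := by
  induction j with
  | zero =>
    simp only [Nat.add_zero]
    exact tendsto_const_nhds.congr fun N => (div_self (criticalTwoPoint_axis_pos N).ne').symm
  | succ j ih =>
    have h1 : Tendsto (fun N : ℕ => criticalTwoPoint 3 (Pi.single 0 ((N + j + 1 : ℕ) : ℤ)) /
        criticalTwoPoint 3 (Pi.single 0 ((N + j : ℕ) : ℤ))) atTop (𝓝 1) :=
      criticalTwoPoint_axis_ratio_tendsto_one.comp (tendsto_add_atTop_nat j)
    have h2 := h1.mul ih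
    rw [one_mul] at h2
    refine h2.congr fun N => ?_
    have hp := criticalTwoPoint_axis_pos (N + j)
    rw [show N + (j + 1) = N + j + 1 from rfl]
    field_simp

end Summit.CriticalPhenomena.Ising3DConformalLimit.AxisRatioRegularity

end
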